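import Mathlib
import Literature.Analysis.ODE.InverseSquareCorrectedChain
import Literature.Analysis.PDE.TowerChannelEnergy
import HarnessLib

/-!
# The true `t`-polynomial kernel of `−∂² + V` on the far cone, packaged for the channel estimate

Analysis/PDE support file (everything proved, no definitions). For `ι` smooth with `ι = 1/x` on
`[½,∞)`, `ℓ ≥ 1`, and a continuous potential `V ≥ 0` with `|V − ℓ(ℓ+1)ι²| ≤ A x^{-5/2}` beyond
`y₀ ≥ 1`, `exists_farTrueTowers` produces, with the explicit tower coefficients
`c_j = ∏_{k<ℓ}(j−2k−1)`: a radius `x₁ ≥ y₀`, a constant `K ≥ 0`, the corrected chain `E_0,…,E_ℓ`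
(`C²`, `E_j'' = VE_j + j(j−1)E_{j−2}` on `x > ½`, `|E_j − c_jι^{ℓ−j}| ≤ Kx^{j−ℓ−1/2}`,
`|(E_j − c_jι^{ℓ−j})'| ≤ Kx^{j−ℓ−3/2}` on `[x₁,∞)`) and the towers
`P_m(t,x) = Σ_i binom(m,i)E_{m−i}(x)tⁱ` (`m ≤ ℓ`): globally `C²`, exact solutions of
`ψ_tt − ψ_xx + Vψ = 0` on `{x > ½}`, with data `(E_m, mE_{m−1})`, and with VANISHING far channel
energy on every cone `{x > ρ + |t|}`, `ρ ≥ x₁` (real integrals `→ 0` at `±∞`, integrable slices).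
These are the kernel elements subtracted in the far-side channel estimate of `FixedModeChannels`
(route PhotonSphereChannels, stmt-FinalStateConjecture-10048). Everything is a repackaging of
`InverseSquareCorrectedChain`, `InverseSquareCorrectedTowers`, `TowerChannelEnergy` and the exact
chain bounds; folklore.
-/

noncomputable section

namespace Literature.Analysis.PDE

open MeasureTheory Set Filter Topology Finset Literature.Analysis.ODE

variable {ι V : ℝ → ℝ}

/-- **True towers with vanishing channel energy.** See the module docstring. [folklore] -/
theorem exists_farTrueTowers (hι : ContDiff ℝ (⊤ : ℕ∞) ι)
    (hιeq : ∀ x : ℝ, 1 / 2 ≤ x → ι x = x⁻¹) (hV : Continuous V) (hV0 : ∀ x, 0 ≤ V x)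
    (ℓ : ℕ) (hℓ : 1 ≤ ℓ) {A y₀ : ℝ} (hy₀ : 1 ≤ y₀)
    (hVb : ∀ x, y₀ ≤ x → |V x - ℓ * (ℓ + 1) * ι x ^ 2| ≤ A * x ^ (-(5 / 2 : ℝ))) :
    ∃ (E : ℕ → ℝ → ℝ) (x₁ K : ℝ), y₀ ≤ x₁ ∧ 0 ≤ K ∧
      (∀ j, j ≤ ℓ → ContDiff ℝ 2 (E j)) ∧
      (∀ j, j ≤ ℓ → ∀ x, 1 / 2 < x →
        deriv (deriv (E j)) x = V x * E j x + (j : ℝ) * (j - 1) * E (j - 2) x) ∧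
      (∀ j, j ≤ ℓ → ∀ x, x₁ ≤ x →
        |E j x - (∏ k ∈ range ℓ, ((j : ℝ) - 2 * k - 1)) * ι x ^ (ℓ - j)| ≤ K * x ^ ((j : ℝ) - ℓ - 1 / 2) ∧
        |deriv (E j) x - deriv (fun y => (∏ k ∈ range ℓ, ((j : ℝ) - 2 * k - 1)) * ι y ^ (ℓ - j)) x|
          ≤ K * x ^ ((j : ℝ) - ℓ - 3 / 2)) ∧
      (∀ m, m ≤ ℓ → ContDiff ℝ 2 (Function.uncurry fun t x =>
        ∑ i ∈ range (m + 1), (m.choose i : ℝ) * E (m - i) x * t ^ i)) ∧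
      (∀ m, m ≤ ℓ → ∀ (t : ℝ) {x : ℝ}, 1 / 2 < x →
        iteratedDeriv 2 (fun τ => ∑ i ∈ range (m + 1), (m.choose i : ℝ) * E (m - i) x * τ ^ i) t
          - iteratedDeriv 2 (fun y => ∑ i ∈ range (m + 1), (m.choose i : ℝ) * E (m - i) y * t ^ i) x
          + V x * ∑ i ∈ range (m + 1), (m.choose i : ℝ) * E (m - i) x * t ^ i = 0) ∧
      (∀ m, m ≤ ℓ → ∀ x : ℝ,
        (∑ i ∈ range (m + 1), (m.choose i : ℝ) * E (m - i) x * (0 : ℝ) ^ i) = E m x ∧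
        deriv (fun τ => ∑ i ∈ range (m + 1), (m.choose i : ℝ) * E (m - i) x * τ ^ i) 0
          = (m : ℝ) * E (m - 1) x) ∧
      (∀ m, m ≤ ℓ → ∀ ρ, x₁ ≤ ρ →
        (∀ t, IntegrableOn (fun z =>
          deriv (fun τ => ∑ i ∈ range (m + 1), (m.choose i : ℝ) * E (m - i) z * τ ^ i) t ^ 2
            + deriv (fun y => ∑ i ∈ range (m + 1), (m.choose i : ℝ) * E (m - i) y * t ^ i) z ^ 2
            + V z * (∑ i ∈ range (m + 1), (m.choose i : ℝ) * E (m - i) z * t ^ i) ^ 2)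
          (Ioi (ρ + |t|))) ∧
        Tendsto (fun t => ∫ z in Ioi (ρ + |t|),
          (deriv (fun τ => ∑ i ∈ range (m + 1), (m.choose i : ℝ) * E (m - i) z * τ ^ i) t ^ 2
            + deriv (fun y => ∑ i ∈ range (m + 1), (m.choose i : ℝ) * E (m - i) y * t ^ i) z ^ 2
            + V z * (∑ i ∈ range (m + 1), (m.choose i : ℝ) * E (m - i) z * t ^ i) ^ 2)) atTop (𝓝 0) ∧
        Tendsto (fun t => ∫ z in Ioi (ρ + |t|),
          (deriv (fun τ => ∑ i ∈ range (m + 1), (m.choose i : ℝ) * E (m - i) z * τ ^ i) t ^ 2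
            + deriv (fun y => ∑ i ∈ range (m + 1), (m.choose i : ℝ) * E (m - i) y * t ^ i) z ^ 2
            + V z * (∑ i ∈ range (m + 1), (m.choose i : ℝ) * E (m - i) z * t ^ i) ^ 2)) atBot (𝓝 0)) := by
  -- the coefficients and the corrected chain
  set c : ℕ → ℝ := fun j => ∏ k ∈ range ℓ, ((j : ℝ) - 2 * k - 1) with hc
  have hcrec : ∀ j : ℕ, 2 ≤ j → ((j : ℝ) - 1) * c (j - 2) = ((j : ℝ) - 2 * ℓ - 1) * c j :=
    fun j hj => towerCoeff_rec ℓ hj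
  have hc1 : 1 ≤ ℓ → c 1 = 0 := fun h => towerCoeff_one h
  obtain ⟨E, x₁, K, hx₁, hK0, hEC, hED, hEb⟩ :=
    exists_correctedChain hι hιeq hV ℓ hcrec hc1 hy₀ hVb
  have hx₁1 : 1 ≤ x₁ := hy₀.trans hx₁
  refine ⟨E, x₁, K, hx₁, hK0, hEC, hED, hEb,
    fun m hm => correctedTower_contDiff hEC hm,
    fun m hm t x hx => correctedTower_wave hEC hED hm t hx,
    fun m hm x => correctedTower_data hEC hm x,
    fun m hm ρ hρ => ?_⟩
  -- size bounds of the chain on `[x₁, ∞)`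
  set Cc : ℝ := ∑ j ∈ range (ℓ + 1), |c j| with hCc
  have hCc0 : 0 ≤ Cc := Finset.sum_nonneg fun j _ => abs_nonneg _
  have hcj : ∀ j, j ≤ ℓ → |c j| ≤ Cc := fun j hj =>
    Finset.single_le_sum (f := fun j => |c j|) (fun j _ => abs_nonneg _) (mem_range.2 (Nat.lt_succ_of_le hj))
  set Ce : ℝ := Cc * ((ℓ : ℝ) + 1) + K with hCe
  have hCe0 : 0 ≤ Ce := by positivity
  have hEsize : ∀ k, k ≤ ℓ → ∀ z, x₁ ≤ z →
      |E k z| ≤ Ce * z ^ ((k : ℝ) - ℓ) ∧ |deriv (E k) z| ≤ Ce * z ^ ((k : ℝ) - ℓ - 1) := by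
    intro k hk z hz
    have hz1 : 1 ≤ z := hx₁1.trans hz
    have hz0 : 0 < z := by linarith
    obtain ⟨h1, h2⟩ := hEb k hk z hz
    obtain ⟨e1, e2⟩ := exact_chain_bounds hιeq ℓ c hk hz1
    have hmono : ∀ a b : ℝ, a ≤ b → z ^ a ≤ z ^ b := fun a b hab =>
      Real.rpow_le_rpow_of_exponent_le hz1 hab
    have hℓ1 : (1 : ℝ) ≤ (ℓ : ℝ) + 1 := by linarith [(Nat.cast_nonneg ℓ : (0 : ℝ) ≤ ℓ)]
    constructor
    · calc |E k z| ≤ |E k z - c k * ι z ^ (ℓ - k)| + |c k * ι z ^ (ℓ - k)| := by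
            have := abs_add_le (E k z - c k * ι z ^ (ℓ - k)) (c k * ι z ^ (ℓ - k))
            rwa [sub_add_cancel] at this
        _ ≤ K * z ^ ((k : ℝ) - ℓ - 1 / 2) + |c k| * z ^ ((k : ℝ) - ℓ) := by rw [← e1]; exact add_le_add h1 le_rfl
        _ ≤ K * z ^ ((k : ℝ) - ℓ) + (Cc * ((ℓ : ℝ) + 1)) * z ^ ((k : ℝ) - ℓ) := by
            have hck : |c k| ≤ Cc * ((ℓ : ℝ) + 1) :=
              calc |c k| = |c k| * 1 := (mul_one _).symm
                _ ≤ Cc * ((ℓ : ℝ) + 1) := mul_le_mul (hcj k hk) hℓ1 zero_le_one hCc0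
            exact add_le_add (mul_le_mul_of_nonneg_left (hmono _ _ (by linarith)) hK0)
              (mul_le_mul_of_nonneg_right hck (Real.rpow_nonneg hz0.le _))
        _ = Ce * z ^ ((k : ℝ) - ℓ) := by rw [hCe]; ring
    · calc |deriv (E k) z|
          ≤ |deriv (E k) z - deriv (fun y => c k * ι y ^ (ℓ - k)) z| + |deriv (fun y => c k * ι y ^ (ℓ - k)) z| := by
            have := abs_add_le (deriv (E k) z - deriv (fun y => c k * ι y ^ (ℓ - k)) z)
              (deriv (fun y => c k * ι y ^ (ℓ - k)) z)
            rwa [sub_add_cancel] at this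
        _ ≤ K * z ^ ((k : ℝ) - ℓ - 3 / 2) + |c k| * ℓ * z ^ ((k : ℝ) - ℓ - 1) := add_le_add h2 e2
        _ ≤ K * z ^ ((k : ℝ) - ℓ - 1) + (Cc * ((ℓ : ℝ) + 1)) * z ^ ((k : ℝ) - ℓ - 1) := by
            have hckl : |c k| * ℓ ≤ Cc * ((ℓ : ℝ) + 1) :=
              mul_le_mul (hcj k hk) (by linarith) (Nat.cast_nonneg ℓ) hCc0
            exact add_le_add (mul_le_mul_of_nonneg_left (hmono _ _ (by linarith)) hK0)
              (mul_le_mul_of_nonneg_right hckl (Real.rpow_nonneg hz0.le _))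
        _ = Ce * z ^ ((k : ℝ) - ℓ - 1) := by rw [hCe]; ring
  -- the potential is `O(z⁻²)` on `[x₁, ∞)`
  have hx₁0 : 0 < x₁ := by linarith
  have hA : 0 ≤ A := by
    have h := hVb x₁ hx₁
    have hp : 0 < x₁ ^ (-(5 / 2 : ℝ)) := Real.rpow_pos_of_pos hx₁0 _
    nlinarith [abs_nonneg (V x₁ - ℓ * (ℓ + 1) * ι x₁ ^ 2)]
  set W₀ : ℝ := (ℓ : ℝ) * (ℓ + 1) + A with hW₀
  have hW₀0 : 0 ≤ W₀ := by positivity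
  have hWb : ∀ z, x₁ ≤ z → V z ≤ W₀ * z ^ (-(2 : ℝ)) := by
    intro z hz
    have hz1 : 1 ≤ z := hx₁1.trans hz
    have hz0 : 0 < z := by linarith
    have h := hVb z (hx₁.trans hz)
    have hι2 : ι z ^ 2 = z ^ (-(2 : ℝ)) := by
      rw [hιeq z (by linarith), inv_pow, Real.rpow_neg hz0.le, Real.rpow_two]
    have h52 : z ^ (-(5 / 2 : ℝ)) ≤ z ^ (-(2 : ℝ)) := Real.rpow_le_rpow_of_exponent_le hz1 (by norm_num)
    have hle := (abs_le.1 h).2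
    rw [hι2] at hle
    calc V z ≤ ℓ * (ℓ + 1) * z ^ (-(2 : ℝ)) + A * z ^ (-(5 / 2 : ℝ)) := by linarith
      _ ≤ ℓ * (ℓ + 1) * z ^ (-(2 : ℝ)) + A * z ^ (-(2 : ℝ)) := by gcongr
      _ = W₀ * z ^ (-(2 : ℝ)) := by rw [hW₀]; ring
  obtain ⟨C, h1, h2, h3, h4⟩ := correctedTower_farEnergy_tendsto_zero (W := V) hV hV0 hx₁1 hCe0 hW₀0 hWb
    hEC hm hEsize hρ
  exact ⟨h1, h3, h4⟩

end Literature.Analysis.PDE
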